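import Mathlib
import HarnessLib
import Summits.NavierStokesRegularity.NavierStokesRegularity.Theses.TypeIQuarterGate
import Summits.NavierStokesRegularity.NavierStokesRegularity.Theorems.TypeIQuarterGateScarZoomDefs
import Summits.NavierStokesRegularity.NavierStokesRegularity.Theorems.TypeIQuarterGateScarEnvelopeTypeIBlowupIsCompact
import Summits.NavierStokesRegularity.NavierStokesRegularity.Theorems.TypeIQuarterGateScarEnvelopeTypeIViolatorsApproachScar
import Summits.NavierStokesRegularity.NavierStokesRegularity.Theorems.TypeIQuarterGateScarEnvelopeTypeIScarZoom

/-!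
# Crux `TypeIQuarterGate.ScarEnvelopeTypeI` (stmt-NavierStokesRegularity-23843) — line `scar_zoom`'s
# end state as a tree theorem: the crux from the Liouville wall S_C

With every non-deciding stub of both lines landed (`scar_zoom`: S0 p611204, S_A p607379, S_B p610713;
`slice_budget`: the same S0 / S_A and SB p615740), the crux 23843 sits exactly on ONE open statement per
line.  This file records the two compositions as importable theorems (the skeletons
`Cruxes/ScarEnvelopeTypeI/Lines/{scar_zoom,slice_budget}.lean` are workfiles and cannot be imported):

* `scarEnvelopeTypeI_of_noTwinScarObject` — line `scar_zoom`'s composition: the two-point Type-I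
  ancient mild Liouville statement S_C `∀ M v, ¬ TwinScarObject M v` (width 0, wall-grade, never
  staffed) implies the crux;
* `sliceOctaveBudget_of_noTwinScarObject` — hence S_C implies line `slice_budget`'s deciding stub SD
  (through the crux and `octaveBudget_of_envelope`): the budget line's open core is WEAKER than (implied
  by) the Liouville wall, and by `scarEnvelopeTypeI_iff_sliceOctaveBudget` (p616631) it is equivalent
  to the crux itself.

HONEST FRAMING: S_C, SD, the crux, its parent `QuarterLawTypeI` and the summit are all OPEN; this file
proves implications between open statements only.
-/

noncomputable section

-- the summit-side namespace `Summit.NavierStokesRegularity.NavierStokesRegularity.…` (single-conjunct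
-- summit, D-0017) repeats a component by design; the dupNamespace linter would flag every declaration.
set_option linter.dupNamespace false

namespace Summit.NavierStokesRegularity.NavierStokesRegularity.Cruxes.ScarEnvelopeTypeI.SliceBudget

open Summit.NavierStokesRegularity.NavierStokesRegularity.Cruxes.ScarEnvelopeTypeI.ScarZoom
  (CruxHypotheses TwinScarObject stub_blowupIsCompact stub_violatorsApproachScar stub_scarZoom)

/-- **Line `scar_zoom`'s composition as a tree theorem**: the two-point Type-I ancient mild
Liouville statement S_C (`∀ M v, ¬ TwinScarObject M v`, the line's deciding stub
`stub_noCascadeSplitting`, OPEN) implies the crux `ScarEnvelopeTypeI` — by the landed STUB 0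
(`stub_blowupIsCompact`), STUB A (`stub_violatorsApproachScar`) and STUB B (`stub_scarZoom`) of that
line: a violator sequence of the envelope at a scar zooms to a twin-scar object. -/
theorem scarEnvelopeTypeI_of_noTwinScarObject
    (hC : ∀ (M : ℝ) (v : ℝ → EuclideanSpace ℝ (Fin 3) → EuclideanSpace ℝ (Fin 3)),
      ¬ TwinScarObject M v) :
    Summit.NavierStokesRegularity.NavierStokesRegularity.Theses.TypeIQuarterGate.ScarEnvelopeTypeI := by
  intro ν T hν hT u p hmax hLH hdec hTI hfin
  by_contra hEnv
  have H : CruxHypotheses ν T u p := ⟨hν, hT, hmax, hLH, hdec, hTI, hfin⟩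
  obtain ⟨M, v, hv⟩ :=
    stub_scarZoom ν T u p H (stub_violatorsApproachScar ν T u p H (stub_blowupIsCompact ν T u p H) hEnv)
  exact hC M v hv

end Summit.NavierStokesRegularity.NavierStokesRegularity.Cruxes.ScarEnvelopeTypeI.SliceBudget

end
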